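import Mathlib.AlgebraicGeometry.EllipticCurve.ModelsWithJ
import Literature.AlgebraicGeometry.Motives.AbelianVarietyProduct
import Literature.AlgebraicGeometry.Motives.AbelianVarietyProductDimProofs
import Literature.AlgebraicGeometry.Motives.VarietiesDimensionProofs
import Literature.NumberTheory.EllipticCurves.AbelianVarietyBridgeFullProofs
import HarnessLib

/-!
# Abelian varieties of every dimension exist; the off-diagonal endomorphism of a square

Topic `AlgebraicGeometry/Motives` (namespace `Literature.AlgebraicGeometry.Motives`). Existence facts on
the tree's REAL carriers (`Motives.AbelianVariety K` = proper geometrically-integral group scheme), which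
several seats had recorded as unavailable ("no positive-dimensional `AbelianVariety` is constructible",
e.g. `Summits/…/Cruxes/WeilTenfoldsSqrtMinus11/Disproof.lean` F2, 2026-08-16) and which became provable
once `WeierstrassCurve.abelianVarietyOfAddHom` (`NumberTheory/EllipticCurves/AbelianVarietyModelOfAddHom`,
assembled unconditionally in `AbelianVarietyBridgeFullProofs`) and `Motives.schemeDim_eq_holds` landed:

* `dim_abelianVarietyOfAddHom` — the abelian-variety model `E_W` of an elliptic Weierstrass curve `W`
  over any field (the plane cubic with the chord–tangent law) has dimension `1`
  (`schemeDim_eq_holds` on `WeierstrassCurve.isSmoothProjective_scheme`; Silverman III.3.1(c), III.3.6);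
* `exists_abelianVariety_dim_eq_one`, `exists_abelianVariety_dim_eq_succ` — over every field there are
  abelian varieties of every positive dimension (`E_W` for Mathlib's `WeierstrassCurve.ofJ 37` and its
  powers, `AbelianVariety.dim_prod`);
* `offDiagonal_comp_self` — on `X × X` the off-diagonal endomorphism `φ = ⟨snd ≫ d, fst⟩ :
  (x, y) ↦ (d·y, x)` satisfies `φ ≫ φ = d` for every `d : ℤ` (pure preadditive algebra: Mumford §19,
  `Hom(X, Y)` is a `ℤ`-module and composition is bilinear); `exists_endomorphism_prod_self_comp_self_eq`;
* `exists_abelianSurface_comp_self_eq` (every field, every `d : ℤ`) and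
  `exists_abelianSurface_comp_self_eq_neg_eleven` (over `ℂ`, `d = -11`, in the exact typing
  `φ ≫ φ = -((11 : ℤ) • 𝟙 B)` of the Weil-type hypotheses of route `HeckePrymWeil`).

Provenance: extracted by the line lead of crux `WeilTenfoldsSqrtMinus11` (stmt-HodgeConjecture-1262, line
`generic-ppav-secant-descent`, stub `stub_hyperbolicPartner`, wave 1). CAVEAT (why this does not give
Weil-type PARTNERS): for a curve `E` without complex multiplication `(E × E, φ)` is the SPLIT Weil-type
surface (`pr₁` is an idempotent `e` with `e φ e = 0 = (1-e) φ (1-e)`), its `K`-compatible polarizations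
form one ray and its discriminant class is `-1`; prescribed discriminants need CM endomorphisms
(`√-d : E ⟶ E` as a scheme morphism), which the tree does not construct yet. Deliberately NOT here:
cohomology of these varieties (`H¹`, Künneth), CM curves, Jacobians.

## References

* [MumfordAV1970] D. Mumford, Abelian Varieties (1970), §4, §19.
* [SilvermanAEC2009] J. H. Silverman, The Arithmetic of Elliptic Curves, 2nd ed., III.3.1(c), III.3.6.
* [GortzWedhorn2020] U. Görtz, T. Wedhorn, Algebraic Geometry I, 2nd ed., Lemma 6.26, Remark 16.54.
-/
noncomputable section

open CategoryTheory AlgebraicGeometry MonoidalCategory CartesianMonoidalCategory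
open Literature.AlgebraicGeometry Literature.AlgebraicGeometry.Motives

universe u

namespace Literature.AlgebraicGeometry.Motives

/-! ### Elliptic curves are one-dimensional abelian varieties (on the tree's real carriers) -/

/-- **`dim E_W = 1`**: the abelian-variety model of an elliptic Weierstrass curve `W` over a field
`K` built from addition and negation morphisms (`WeierstrassCurve.abelianVarietyOfAddHom`; its
underlying scheme is the plane cubic `W.scheme`) has dimension one — `W.scheme` is smooth projective
of relative dimension `1` (`WeierstrassCurve.isSmoothProjective_scheme`, Silverman III.3.1(c)) and a
smooth projective geometrically irreducible `K`-scheme of relative dimension `n` has dimension `n`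
(`Motives.schemeDim_eq_holds`, Görtz–Wedhorn I Lemma 6.26). [cite: SilvermanAEC2009, III.3.1(c) and III.3.6] -/
theorem dim_abelianVarietyOfAddHom {K : Type u} [Field K] (W : WeierstrassCurve K) [W.IsElliptic]
    (add : W.scheme ⊗ W.scheme ⟶ W.scheme) (neg : W.scheme ⟶ W.scheme)
    (hadd : ∀ P Q : W.geomPoints, lift (W.pointEquiv (L := AlgebraicClosure K) P)
      (W.pointEquiv (L := AlgebraicClosure K) Q) ≫ add = W.pointEquiv (L := AlgebraicClosure K) (P + Q))
    (hneg : ∀ P : W.geomPoints, W.pointEquiv (L := AlgebraicClosure K) P ≫ neg =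
      W.pointEquiv (L := AlgebraicClosure K) (-P)) :
    (W.abelianVarietyOfAddHom add neg hadd hneg).dim = 1 :=
  schemeDim_eq_holds W.isSmoothProjective_scheme

/-- **Elliptic curves exist as abelian varieties**: over every field `K` there is an abelian variety
of dimension `1` — the plane cubic of Mathlib's elliptic curve `WeierstrassCurve.ofJ 37` with the
chord–tangent group law (`WeierstrassCurve.addHom`, `WeierstrassCurve.negHom`, Bosma–Lenstra charts;
Silverman III.3.6). [cite: SilvermanAEC2009, III.3.6] -/
theorem exists_abelianVariety_dim_eq_one (K : Type u) [Field K] :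
    ∃ E : AbelianVariety K, E.dim = 1 := by
  classical
  let W : WeierstrassCurve K := WeierstrassCurve.ofJ 37
  exact ⟨W.abelianVarietyOfAddHom W.addHom W.negHom W.lift_pointEquiv_comp_addHom
    W.pointEquiv_comp_negHom_geom, dim_abelianVarietyOfAddHom W _ _ _ _⟩

/-- **Abelian varieties of every positive dimension exist** over every field: the powers
`E × ⋯ × E` of an elliptic curve, `dim (A × E) = dim A + 1` (`AbelianVariety.dim_prod`). [folklore] -/
theorem exists_abelianVariety_dim_eq_succ (K : Type u) [Field K] (g : ℕ) :
    ∃ A : AbelianVariety K, A.dim = g + 1 := by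
  obtain ⟨E, hE⟩ := exists_abelianVariety_dim_eq_one K
  induction g with
  | zero => exact ⟨E, hE⟩
  | succ g ih =>
    obtain ⟨A, hA⟩ := ih
    exact ⟨A.prod E, by rw [AbelianVariety.dim_prod, hA, hE]⟩

/-! ### The off-diagonal endomorphism of a square -/

/-- **The off-diagonal endomorphism squares to a scalar.** For an abelian variety `X` over a field
and `d : ℤ`, the endomorphism `φ = ⟨snd ≫ d·𝟙, fst⟩` of `X × X`, `(x, y) ↦ (d·y, x)`, satisfies
`φ ≫ φ = d · 𝟙`: both composites with the projections agree (`prodLift_fst`, `prodLift_snd`,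
bilinearity of composition in the preadditive category of abelian varieties, Mumford §19).
[cite: MumfordAV1970, §19 (Hom(X,Y) and bilinearity of composition)] -/
theorem offDiagonal_comp_self {K : Type u} [Field K] (X : AbelianVariety K) (d : ℤ) :
    AbelianVariety.prodLift (AbelianVariety.snd X X ≫ (d • 𝟙 X)) (AbelianVariety.fst X X) ≫
        AbelianVariety.prodLift (AbelianVariety.snd X X ≫ (d • 𝟙 X)) (AbelianVariety.fst X X) =
      d • 𝟙 (X.prod X) := by
  apply AbelianVariety.prod_hom_ext
  · rw [Category.assoc, AbelianVariety.prodLift_fst, ← Category.assoc, AbelianVariety.prodLift_snd,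
      Preadditive.comp_zsmul, Preadditive.zsmul_comp, Category.comp_id, Category.id_comp]
  · rw [Category.assoc, AbelianVariety.prodLift_snd, AbelianVariety.prodLift_fst,
      Preadditive.comp_zsmul, Preadditive.zsmul_comp, Category.comp_id, Category.id_comp]

/-- **Every square carries an endomorphism with prescribed scalar square**: for every abelian
variety `X` and `d : ℤ` there is `φ : X × X ⟶ X × X` with `φ ≫ φ = d · 𝟙` (the off-diagonal one).
[cite: MumfordAV1970, §19 (Hom(X,Y) and bilinearity of composition)] -/
theorem exists_endomorphism_prod_self_comp_self_eq {K : Type u} [Field K] (X : AbelianVariety K)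
    (d : ℤ) : ∃ φ : X.prod X ⟶ X.prod X, φ ≫ φ = d • 𝟙 (X.prod X) :=
  ⟨_, offDiagonal_comp_self X d⟩

/-- **A complex abelian surface with `φ_B ≫ φ_B = -11`** (the first two Weil-type clauses, in the
exact typing of route `HeckePrymWeil`): `B = E × E` for a complex elliptic curve `E` and the
off-diagonal `φ_B : (x, y) ↦ (-11·y, x)`. NOTE: this `B` is the SPLIT Weil-type surface (discriminant
class `-1`), not a CM surface (module docstring).
[cite: MumfordAV1970, §19 (Hom(X,Y) and bilinearity of composition)] -/
theorem exists_abelianSurface_comp_self_eq_neg_eleven :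
    ∃ (B : AbelianVariety ℂ) (φB : B ⟶ B), B.dim = 2 ∧ φB ≫ φB = -((11 : ℤ) • 𝟙 B) := by
  obtain ⟨E, hE⟩ := exists_abelianVariety_dim_eq_one ℂ
  obtain ⟨φ, hφ⟩ := exists_endomorphism_prod_self_comp_self_eq E (-11)
  exact ⟨E.prod E, φ, by rw [AbelianVariety.dim_prod, hE], by rw [hφ, neg_zsmul]⟩

/-- The same over every field and for every scalar: abelian surfaces `B` with `φ ≫ φ = d · 𝟙 B`
exist for all `d : ℤ`. [cite: MumfordAV1970, §19 (Hom(X,Y) and bilinearity of composition)] -/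
theorem exists_abelianSurface_comp_self_eq (K : Type u) [Field K] (d : ℤ) :
    ∃ (B : AbelianVariety K) (φB : B ⟶ B), B.dim = 2 ∧ φB ≫ φB = d • 𝟙 B := by
  obtain ⟨E, hE⟩ := exists_abelianVariety_dim_eq_one K
  obtain ⟨φ, hφ⟩ := exists_endomorphism_prod_self_comp_self_eq E d
  exact ⟨E.prod E, φ, by rw [AbelianVariety.dim_prod, hE], hφ⟩

end Literature.AlgebraicGeometry.Motives

end
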